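import Literature.AnabelianGeometry.SemiGraphs.UniversalCoveringOver

/-!
# Change of base component for `𝒢_{∞,S}` ([SemiAnbd] §3 p. 38)

Sequel to `UniversalCoveringOver.lean`: a path class `q : c ⟶ c'` between base components of
`𝔾_S` identifies the coverings `𝒢_{∞,S}` based at `c` and at `c'` (precomposition with `q⁻¹`),
compatibly with the projections to `S` — the independence of `𝒢_{∞,S}` of the base point up to
(non-canonical) isomorphism ([SemiAnbd] p. 38, "independent, up to inner automorphism, of the
choice").
-/

namespace Literature.AnabelianGeometry.SemiGraphs

namespace ProfiniteSemiGraph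

open CategoryTheory

universe u

variable {𝒢 : ProfiniteSemiGraph.{u}} (S : CovObj 𝒢) {c c' : S.orbitGraph.CatCarrier}
  (q : S.orbitGraph.basept c ⟶ S.orbitGraph.basept c') (h𝒢 : 𝒢.IsCountable)

/-- The morphism `𝒢_{∞,S}(c) → 𝒢_{∞,S}(c')` given by a path class `q : c ⟶ c'`:
`(V, x, p) ↦ (V, x, q⁻¹ ≫ p)`. [cite: MochizukiSemiAnbd2006, Prop 3.6 p.38] -/
noncomputable def CovObj.baseChangeHom : S.univCoverOver c h𝒢 ⟶ S.univCoverOver c' h𝒢 where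
  fV v := ObjectProperty.homMk
    { hom := TypeCat.ofHom fun t : S.FibV c v => (⟨t.1, ⟨t.2.1, inv q ≫ t.2.2⟩⟩ : S.FibV c' v)
      comm := fun _ => rfl }
  fE e := ObjectProperty.homMk
    { hom := TypeCat.ofHom fun t : S.FibE c e => (⟨t.1, ⟨t.2.1, inv q ≫ t.2.2⟩⟩ : S.FibE c' e)
      comm := fun _ => rfl }
  comm b v h := by
    apply ObjectProperty.hom_ext
    apply Action.Hom.ext
    apply ConcreteCategory.hom_ext
    intro t
    exact CovObj.FibV.ext S c' rfl rfl
      (heq_of_eq (Category.assoc (inv q) t.2.2 (S.brArrowOver b v h t.1 t.2.1.1 t.2.1.2)))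

/-- `baseChangeHom q ≫ baseChangeHom q⁻¹ = 𝟙`. [cite: MochizukiSemiAnbd2006, Prop 3.6 p.38] -/
theorem CovObj.baseChangeHom_comp_inv :
    S.baseChangeHom q h𝒢 ≫ S.baseChangeHom (inv q) h𝒢 = 𝟙 _ := by
  have hq : inv (inv q) ≫ inv q = 𝟙 _ := by rw [IsIso.inv_inv, IsIso.hom_inv_id]
  refine CovHom.ext (funext fun v => ?_) (funext fun e => ?_)
  · apply ObjectProperty.hom_ext
    apply Action.Hom.ext
    apply ConcreteCategory.hom_ext
    intro t
    refine CovObj.FibV.ext S c rfl rfl (heq_of_eq ?_)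
    change inv (inv q) ≫ (inv q ≫ t.2.2) = t.2.2
    rw [← Category.assoc, hq, Category.id_comp]
  · apply ObjectProperty.hom_ext
    apply Action.Hom.ext
    apply ConcreteCategory.hom_ext
    intro t
    refine CovObj.FibE.ext S c rfl rfl (heq_of_eq ?_)
    change inv (inv q) ≫ (inv q ≫ t.2.2) = t.2.2
    rw [← Category.assoc, hq, Category.id_comp]

/-- **The base-change isomorphism `𝒢_{∞,S}(c) ≅ 𝒢_{∞,S}(c')`** attached to a path class
`q : c ⟶ c'`. [cite: MochizukiSemiAnbd2006, Prop 3.6 p.38] -/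
noncomputable def CovObj.baseChangeIso : S.univCoverOver c h𝒢 ≅ S.univCoverOver c' h𝒢 where
  hom := S.baseChangeHom q h𝒢
  inv := S.baseChangeHom (inv q) h𝒢
  hom_inv_id := S.baseChangeHom_comp_inv q h𝒢
  inv_hom_id := by
    have h := S.baseChangeHom_comp_inv (inv q) h𝒢
    have e : S.baseChangeHom (inv (inv q)) h𝒢 = S.baseChangeHom q h𝒢 := by
      congr 1
      exact IsIso.inv_inv (f := q)
    rw [e] at h
    exact h

/-- Base change is compatible with the projections to `S`. [cite: MochizukiSemiAnbd2006, Prop 3.6 p.38] -/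
theorem CovObj.baseChangeHom_comp_proj :
    S.baseChangeHom q h𝒢 ≫ S.univCoverOverProj c' h𝒢 = S.univCoverOverProj c h𝒢 := by
  refine CovHom.ext (funext fun v => ?_) (funext fun e => ?_) <;> rfl

end ProfiniteSemiGraph

end Literature.AnabelianGeometry.SemiGraphs
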